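import Mathlib
import Literature.Combinatorics.Additive.TripleProductProperty

/-!
# `SnSubsetDichotomy.NoThresholdSubsetTriple`, line `sidon-regime-hereditary-density` — vocabulary
# (difference sets, translate self-overlap, spreadable sets, and the two named stub statements)

Definitions + their immediate API only; no statement of the route is asserted here. This file is the
shared vocabulary of the registered stubs of the line `sidon-regime-hereditary-density` for the crux
`stmt-MatrixMultiplication-8302` (skeleton `Cruxes/NoThresholdSubsetTriple/Lines/sidon-regime-hereditary-density.lean`,
which imports this file), so that the stub files `…NoThresholdSubsetTripleStubHdCount.lean`,
`…StubSpreadTransfer.lean` and the skeleton speak about the SAME constants: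

* `diffSet X = X·X⁻¹ ∖ {1}` (right quotients, the convention of the tree's `TripleProductProperty`),
  `overlap g X = #{x ∈ X : g·x ∈ X} = |X ∩ g⁻¹X|`, `selfOverlap X = max_{g ≠ 1} overlap g X` (any group);
* on `S_n`: `Spreadable K' n X` — `X` has a sub-set `X₀` with `|X| ≤ e^{K'√n}|X₀|` and
  `selfOverlap X₀ ≤ e^{K'√n}` (the "Sidon-like core" of the idea card `sidon-regime-hereditary-density`);
* the two stub STATEMENTS that occur as hypotheses of the transfer stub: `HDCount` (the
  hereditary-density count, any finite group) and `NoHDProductFreeTriple` (the line's target `C⁺_HD`).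
  They are `Prop`-valued definitions, NOT assertions; `HDCount` is proved in `…StubHdCount.lean`,
  `NoHDProductFreeTriple` is open.
* API: `mem_diffSet`, `one_not_mem_diffSet`, `inv_mem_diffSet`, `overlap_le_selfOverlap`,
  `selfOverlap_le_card`, `mem_diffSet_of_overlap_pos`, and the FIRST LEMMA of the line
  `diffSets_of_tpp` (TPP with non-empty sets ⇒ the three difference sets are pairwise disjoint and the
  ordered triple is product-free; pure algebra, proved).

Sources: idea card `Cruxes/NoThresholdSubsetTriple/Ideas/sidon-regime-hereditary-density.md`; Cohn–Umans
2003 Def. 2.1 (TPP, quotient sets) [CohnUmans2003]; Blasiak–Cohn–Grochow–Pratt–Umans 2023 Rem. 3.7 (quotient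
sets of TPP triples) [BlasiakCohnGrochowPrattUmans2023].
-/

-- `Summit.<Summit>.<Problem>`: summit and problem coincide for this single-conjunct summit.
set_option linter.dupNamespace false

noncomputable section

open scoped Classical
open Finset
open Literature.Combinatorics.Additive

namespace Summit.MatrixMultiplication.MatrixMultiplication.Theorems.NoThresholdSubsetTriple

/-! ### Difference sets, representation counts, self-overlap (any group) -/

section General

variable {G : Type*} [Group G] [DecidableEq G]

/-- The (self-)DIFFERENCE SET `D_X = X·X⁻¹ ∖ {1} = {s s'⁻¹ : s ≠ s' ∈ X}` of a finite set `X`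
(right quotients, the convention of the tree's `TripleProductProperty`: `Q(X) = X X⁻¹`). -/
def diffSet (X : Finset G) : Finset G :=
  (Finset.image₂ (fun s s' => s * s'⁻¹) X X).erase 1

/-- The REPRESENTATION COUNT `r_X(g) = #{x ∈ X : g·x ∈ X} = |X ∩ g⁻¹X| = |gX ∩ X|` = the number of
ordered pairs `(s, s') ∈ X²` with `s s'⁻¹ = g` (`s = g s'`). -/
def overlap (g : G) (X : Finset G) : ℕ :=
  (X.filter fun x => g * x ∈ X).card

/-- The TRANSLATE SELF-OVERLAP `m(X) = max_{g ≠ 1} r_X(g) = max_{g ≠ 1} |X ∩ gX|` (the dichotomy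
parameter of the idea card: `m(X) ≤ e^{K√n}` is the spread / "Sidon" regime, `m(X) = |X|` for a
subgroup). -/
def selfOverlap [Fintype G] (X : Finset G) : ℕ :=
  ((Finset.univ : Finset G).erase 1).sup fun g => overlap g X

/-- Membership in `D_X`: `d ≠ 1` and `d = s s'⁻¹` with `s, s' ∈ X`. -/
theorem mem_diffSet {X : Finset G} {d : G} :
    d ∈ diffSet X ↔ d ≠ 1 ∧ ∃ s ∈ X, ∃ s' ∈ X, s * s'⁻¹ = d := by
  simp only [diffSet, Finset.mem_erase, Finset.mem_image₂]

/-- `1 ∉ D_X`. -/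
theorem one_not_mem_diffSet (X : Finset G) : (1 : G) ∉ diffSet X := by
  simp [mem_diffSet]

/-- `D_X` is symmetric. -/
theorem inv_mem_diffSet {X : Finset G} {d : G} (h : d ∈ diffSet X) : d⁻¹ ∈ diffSet X := by
  rw [mem_diffSet] at h ⊢
  obtain ⟨hd, s, hs, s', hs', rfl⟩ := h
  refine ⟨?_, s', hs', s, hs, by group⟩
  rwa [Ne, inv_eq_one]

/-- Every `r_X(g)`, `g ≠ 1`, is at most `m(X)`. -/
theorem overlap_le_selfOverlap [Fintype G] {X : Finset G} {g : G} (hg : g ≠ 1) :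
    overlap g X ≤ selfOverlap X :=
  Finset.le_sup (f := fun g => overlap g X) (Finset.mem_erase.2 ⟨hg, Finset.mem_univ g⟩)

/-- `m(X) ≤ |X|`. -/
theorem selfOverlap_le_card [Fintype G] (X : Finset G) : selfOverlap X ≤ X.card :=
  Finset.sup_le fun _ _ => Finset.card_filter_le _ _

/-- An element with a positive representation count other than `1` lies in `D_X`. -/
theorem mem_diffSet_of_overlap_pos {X : Finset G} {g : G} (hg : g ≠ 1) (h : 0 < overlap g X) :
    g ∈ diffSet X := by
  obtain ⟨x, hx⟩ := Finset.card_pos.1 h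
  rw [Finset.mem_filter] at hx
  exact mem_diffSet.2 ⟨hg, g * x, hx.2, x, hx.1, by group⟩

/-! ### First lemma (PROVED): TPP ⟹ the three difference sets are pairwise disjoint and the
ordered triple is product-free -/

/-- Product-freeness of `(D_S, D_T, D_U)` is the TPP read on non-trivial quotients. -/
theorem productFree_of_tpp {S T U : Finset G} (h : TripleProductProperty S T U) :
    ∀ d₁ ∈ diffSet S, ∀ d₂ ∈ diffSet T, ∀ d₃ ∈ diffSet U, d₁ * d₂ * d₃ ≠ 1 := by
  intro d₁ h₁ d₂ h₂ d₃ h₃ he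
  rw [mem_diffSet] at h₁ h₂ h₃
  obtain ⟨hd₁, s, hs, s', hs', rfl⟩ := h₁
  obtain ⟨-, t, ht, t', ht', rfl⟩ := h₂
  obtain ⟨-, u, hu, u', hu', rfl⟩ := h₃
  obtain ⟨rfl, -, -⟩ := h s hs s' hs' t ht t' ht' u hu u' hu' he
  exact hd₁ (mul_inv_cancel _)

/-- `D_S ∩ D_T = ∅` under the TPP, provided `U ≠ ∅` (take `q_U = 1`). -/
theorem disjoint_diffSet_ST_of_tpp {S T U : Finset G} (h : TripleProductProperty S T U)
    (hU : U.Nonempty) : Disjoint (diffSet S) (diffSet T) := by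
  rw [Finset.disjoint_left]
  intro d h₁ h₂
  rw [mem_diffSet] at h₁ h₂
  obtain ⟨hd, s, hs, s', hs', rfl⟩ := h₁
  obtain ⟨-, t, ht, t', ht', he⟩ := h₂
  obtain ⟨u, hu⟩ := hU
  have key : s * s'⁻¹ * (t' * t⁻¹) * (u * u⁻¹) = 1 := by
    rw [← he]; group
  obtain ⟨rfl, -, -⟩ := h s hs s' hs' t' ht' t ht u hu u hu key
  exact hd (mul_inv_cancel _)

/-- `D_T ∩ D_U = ∅` under the TPP, provided `S ≠ ∅`. -/
theorem disjoint_diffSet_TU_of_tpp {S T U : Finset G} (h : TripleProductProperty S T U)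
    (hS : S.Nonempty) : Disjoint (diffSet T) (diffSet U) := by
  rw [Finset.disjoint_left]
  intro d h₁ h₂
  rw [mem_diffSet] at h₁ h₂
  obtain ⟨hd, t, ht, t', ht', rfl⟩ := h₁
  obtain ⟨-, u, hu, u', hu', he⟩ := h₂
  obtain ⟨s, hs⟩ := hS
  have key : s * s⁻¹ * (t * t'⁻¹) * (u' * u⁻¹) = 1 := by
    rw [← he]; group
  obtain ⟨-, rfl, -⟩ := h s hs s hs t ht t' ht' u' hu' u hu key
  exact hd (mul_inv_cancel _)

/-- `D_U ∩ D_S = ∅` under the TPP, provided `T ≠ ∅`. -/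
theorem disjoint_diffSet_US_of_tpp {S T U : Finset G} (h : TripleProductProperty S T U)
    (hT : T.Nonempty) : Disjoint (diffSet U) (diffSet S) := by
  rw [Finset.disjoint_left]
  intro d h₁ h₂
  rw [mem_diffSet] at h₁ h₂
  obtain ⟨hd, u, hu, u', hu', rfl⟩ := h₁
  obtain ⟨-, s, hs, s', hs', he⟩ := h₂
  obtain ⟨t, ht⟩ := hT
  have key : s' * s⁻¹ * (t * t⁻¹) * (u * u'⁻¹) = 1 := by
    rw [← he]; group
  obtain ⟨-, -, rfl⟩ := h s' hs' s hs t ht t ht u hu u' hu' key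
  exact hd (mul_inv_cancel _)

/-- FIRST LEMMA of the line (the direction the composition needs; pure algebra, PROVED): for a TPP
triple with all three sets non-empty, the difference sets `D_S, D_T, D_U` are pairwise disjoint and
the ordered triple is product-free. (They are symmetric and miss `1` for every `X`:
`inv_mem_diffSet`, `one_not_mem_diffSet`.) -/
theorem diffSets_of_tpp {S T U : Finset G} (h : TripleProductProperty S T U) (hS : S.Nonempty)
    (hT : T.Nonempty) (hU : U.Nonempty) :
    Disjoint (diffSet S) (diffSet T) ∧ Disjoint (diffSet T) (diffSet U) ∧
      Disjoint (diffSet U) (diffSet S) ∧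
        ∀ d₁ ∈ diffSet S, ∀ d₂ ∈ diffSet T, ∀ d₃ ∈ diffSet U, d₁ * d₂ * d₃ ≠ 1 :=
  ⟨disjoint_diffSet_ST_of_tpp h hU, disjoint_diffSet_TU_of_tpp h hS,
    disjoint_diffSet_US_of_tpp h hT, productFree_of_tpp h⟩

/-- The line's FIRST LEMMA in registered-stub form (`stub_diffSetsOfTPP` of the skeleton
`Lines/sidon-regime-hereditary-density.lean`): TPP with non-empty sets ⇒ the three difference sets
are pairwise disjoint and the ordered triple is product-free. -/
theorem stub_diffSetsOfTPP :
    ∀ (G : Type) [Group G] [DecidableEq G] (S T U : Finset G),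
      TripleProductProperty S T U → S.Nonempty → T.Nonempty → U.Nonempty →
        Disjoint (diffSet S) (diffSet T) ∧ Disjoint (diffSet T) (diffSet U) ∧
          Disjoint (diffSet U) (diffSet S) ∧
            ∀ d₁ ∈ diffSet S, ∀ d₂ ∈ diffSet T, ∀ d₃ ∈ diffSet U, d₁ * d₂ * d₃ ≠ 1 :=
  fun _ _ _ _ _ _ h hS hT hU => diffSets_of_tpp h hS hT hU

end General

/-! ### The dichotomy parameter on `S_n` -/

/-- `X ⊆ S_n` is `K'`-SPREADABLE: it contains a "Sidon-like core" `X₀` of relative size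
`≥ e^{-K'√n}` whose translate self-overlap is at most `e^{K'√n}` (`m(X₀) ≤ e^{K'√n}`).  A random
set of size `√(n!)e^{c√n}` has `m ≈ e^{2c√n}`, so `K'` is to be thought of as larger than the
slack constant; the robust negation "every subset of relative size `≥ e^{-K'√n}` has an
`e^{K'√n}`-popular left translate" is the structured regime (triage r1-3's objection to the bare
`m(X)`: `e^{K'√n}` stray pairs no longer flip the regime). -/
def Spreadable (K' : ℝ) (n : ℕ) (X : Finset (Equiv.Perm (Fin n))) : Prop :=
  ∃ X₀ : Finset (Equiv.Perm (Fin n)), X₀ ⊆ X ∧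
    (X.card : ℝ) ≤ Real.exp (K' * Real.sqrt (n : ℝ)) * (X₀.card : ℝ) ∧
      (selfOverlap X₀ : ℝ) ≤ Real.exp (K' * Real.sqrt (n : ℝ))

/-! ### The two stub statements used as hypotheses of the transfer -/

/-- Statement of STUB 1 — the HEREDITARY-DENSITY COUNT (any finite group): the ordered pairs of
`X` lying in a common right coset of `H` number at least `|X|²/[G:H]` (Cauchy–Schwarz over the
`[G:H]` right cosets); `|X|` of them are diagonal and each off-diagonal one has quotient
`s s'⁻¹ ∈ D_X ∩ H` with fibre size `r_X(s s'⁻¹) ≤ m(X)`.  Hence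
`|X|² ≤ [G:H] · (|X| + m(X) · |D_X ∩ H|)`, i.e. `D_X` has relative density
`≥ (|X|²|H|/|G| − |X|) / (m(X)|H|)` in `H`. -/
def HDCount : Prop :=
  ∀ (G : Type) [Group G] [Fintype G] [DecidableEq G] (H : Subgroup G) (X : Finset G),
    X.card ^ 2 ≤ H.index * (X.card + selfOverlap X * ((diffSet X).filter (· ∈ H)).card)

/-- Statement of STUB 3 — THE TARGET `C⁺_HD` (idea card `NoHereditarilyDenseProductFreeTriple`):
for every `K > 0` and `n ≥ n₀(K)`, three SYMMETRIC subsets `D₀, D₁, D₂ ⊆ S_n ∖ {1}`, pairwise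
DISJOINT, each of relative density `≥ e^{-K√n}` inside EVERY subgroup `H ≤ S_n` of order
`≥ √(n!)·e^{K√n}` (hereditarily dense), contain a solution of `d₀ d₁ d₂ = 1` (`dᵢ ∈ Dᵢ`).
Membership in `H` is filtered with the classical decidability instance (`open scoped Classical`),
as everywhere in this file and in the route file. -/
def NoHDProductFreeTriple : Prop :=
  ∀ K : ℝ, 0 < K → ∃ n₀ : ℕ, ∀ n ≥ n₀, ∀ D : Fin 3 → Finset (Equiv.Perm (Fin n)),
    (∀ i, ∀ d ∈ D i, d⁻¹ ∈ D i) → (∀ i, (1 : Equiv.Perm (Fin n)) ∉ D i) →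
      (∀ i j, i ≠ j → Disjoint (D i) (D j)) →
        (∀ i, ∀ H : Subgroup (Equiv.Perm (Fin n)),
            Real.sqrt (n.factorial : ℝ) * Real.exp (K * Real.sqrt (n : ℝ)) ≤ (Nat.card H : ℝ) →
              Real.exp (-(K * Real.sqrt (n : ℝ))) * (Nat.card H : ℝ) ≤
                (((D i).filter (· ∈ H)).card : ℝ)) →
          ∃ d₁ ∈ D 0, ∃ d₂ ∈ D 1, ∃ d₃ ∈ D 2, d₁ * d₂ * d₃ = 1


end Summit.MatrixMultiplication.MatrixMultiplication.Theorems.NoThresholdSubsetTriple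

end
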